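import Summits.QuantumFields.BalabanUV.Beta.FP.GhostLoopCountingMixGamma
import Summits.QuantumFields.BalabanUV.Beta.FP.GhostLoopCountingMixCubic

/-!
# `Beta/FP/GhostLoopCountingMixRate` — road «FP» (binder row D1), organisation γ, row **(GH-a) COUNTING, piece (g4)**: THE GHOST (MIX-1)∕(MIX-3) ENDs WITH THE PROFILE
# RATE FREE IN `(0, deltaH 4 1]` — the ghost-side mirror of the gluon `MixLoopInstanceBlockFamilyGamma.latticeColumn_letterJ_of_le` (monotonicity of the (I-gh) column letters in the
# rate), so that the LEDGER may take `δ := min(deltaH 4 1, δ_Γ)` when the `Γ = Gh` leg's own rate `δ_Γ` is smaller ([folklore] monotone corollary; no road object identified)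

HONEST FRAMING (cell `pub-balaban`, β sub-cell, verbatim): discharging `BetaPertH` makes Bałaban's UV stability UNCONDITIONAL — a real constructive-QFT
result; it is NOT the continuum limit and NOT the Clay problem.  THIS MODULE is a [folklore] corollary of this lineage's `GhostLoopCountingMix.ghostColumn_engineLetters`
(`e^{−(δ₀∕N)x} ≤ e^{−(δ∕N)x}` for `δ ≤ δ₀`, `x ≥ 0`) fed BY NAME into `GhostLoopCountingMixGamma.coarse_mix1_secondMoment_scl` and `GhostLoopCountingMixCubic.coarse_mix3_secondMoment_scl`;
no `def`, no `def … : Prop`, nothing cited, 0 sorry.  NOT the `Γ`∕`𝔊`∕`Ḣ` instances (RHOA-4-GH loc ∕ `CoarseInverseScalar` ∕ LEDGER), NOT the instance number (KER-γ (γ)), NOT (GH-a) as a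
whole, NOT `Mix_n = O(1)`, NOT hbook, NOT D1, NOT BetaPertH, NOT continuum, NOT Clay.
HONEST DEPENDENCY: continuum YM on T⁴ ⇐ BetaPertH ∧ nine spine estimates (0/9 proved); BetaPertH ⇐ (D1) ∧ (D4) ∧ CAP+tail; G-an2-4 gates asym, D1 and NE2/3/4.

ABSOLUTE RULE (cell charter, verbatim): «No internally-minted statement may enter as a cited fact. Every hypothesis is either kernel-proved in this package or a
verbatim quotation of a PUBLISHED theorem with page reference. The manuscript(s) under audit are NOT citable for their own disputed steps — they are the thing under
adjudication; programme-internal (2001/route/tribunal) claims are never citable.»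

CONTENT.  `ghostColumn_engineLetters_of_le` (ONE `C, C′ ≥ 0` such that for ALL `δ ∈ (0, deltaH 4 1]`, all `a > 0`, `N ≥ 1`: (I)∕(J) at rate `δ∕N` and (J′));
**`ghost_mix1_rem_of_le`** and **`ghost_mix3_rem_of_le`** = `ghost_mix1_rem` ∕ `ghost_mix3_rem` with `∀ δ, 0 < δ → δ ≤ deltaH 4 1 →` in front and `δ` in place of `deltaH 4 1`
throughout (the `Γ` letters (Γ)∕(Γ₁) at rate `δ∕N`, the bounds' `δ`-numbers at `δ`).
Provenance: D1 formalisation swarm, unit `b2b-balaban-beta-d1-formalise-leaf-05` gen 14 (staged) ∕ gen 15 (filed), 2026-08-21; offer O-d1leaf05g14-1 (2), road-FP OWNER d1-p3-g9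
«GO» (journal 2026-08-21T04:56:14Z).  WHY A SIBLING MODULE and not an in-file v1.1 append to `GhostLoopCountingMix`: the two ENDs restated here live in `GhostLoopCountingMixGamma` ∕
`GhostLoopCountingMixCubic`, both of which IMPORT `GhostLoopCountingMix` — appending their `_of_le` twins to `GhostLoopCountingMix` would close an import cycle; the three landed files stay
byte-identical (their cross-reads of record stand).  «Not in print; our bookkeeping»; no existing file touched.
-/

noncomputable section

namespace Summit.QuantumFields.BalabanUV.Beta.FP.GhostLoopCountingMixRate

open Finset Real
open scoped BigOperators
open Literature.MathematicalPhysics.QuantumFieldTheory.Balaban1983to89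
open Literature.MathematicalPhysics.QuantumFieldTheory.Balaban1983to89.Beta
open B12Sec2to5 (l1)
open ExpKernelCalculus (Zl)
open DyadicShell (Pt supNorm)
open AxialBlockWeights (fineBlock)
open B5Hk103ScalarZd (kerH deltaH deltaH_pos)
open Summit.QuantumFields.BalabanUV.Beta.FP.AveragingJetLettersRooted (ker₁)
open Summit.QuantumFields.BalabanUV.Beta.FP.ScalarAveragingJetLetters (sclW sclFld sclBg)
open Summit.QuantumFields.BalabanUV.Beta.FP.GhostLoopCountingMix (ghostColumn_engineLetters)
open Summit.QuantumFields.BalabanUV.Beta.FP.GhostLoopCountingMixGamma (coarse_mix1_secondMoment_scl)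
open Summit.QuantumFields.BalabanUV.Beta.FP.GhostLoopCountingMixCubic (coarse_mix3_secondMoment_scl)

/-- **THE (I-gh) LETTERS AT ANY RATE `δ ≤ deltaH 4 1`** ([folklore] monotone corollary of `ghostColumn_engineLetters`): ONE `C, C′ ≥ 0` such that for ALL `δ ∈ (0, deltaH 4 1]`,
`a > 0`, `N ≥ 1`: (I)∕(J) `|kerH (N−1) a c u| ≤ C·e^{−(δ∕N)‖c − N•u‖∞}` and (J′) `Σ_{v∈V}(1 + (‖b′−N•v‖∞∕N)²)|kerH (N−1) a b′ v| ≤ C′`. -/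
theorem ghostColumn_engineLetters_of_le :
    ∃ C C' : ℝ, 0 ≤ C ∧ 0 ≤ C' ∧ ∀ δ : ℝ, 0 < δ → δ ≤ deltaH 4 1 → ∀ {a : ℝ}, 0 < a → ∀ (N : ℕ), 1 ≤ N →
      (∀ c u : Pt, |kerH (N - 1) a c u| ≤ C * Real.exp (-(δ / N) * (supNorm (c - (N : ℤ) • u) : ℝ))) ∧
      (∀ (b' : Pt) (V : Finset Pt),
        ∑ v ∈ V, (1 + ((supNorm (b' - (N : ℤ) • v) : ℝ) / N) ^ 2) * |kerH (N - 1) a b' v| ≤ C') := by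
  obtain ⟨C, C', hC, hC', h⟩ := ghostColumn_engineLetters
  refine ⟨C, C', hC, hC', fun δ _ hδle {a} ha N hN => ?_⟩
  obtain ⟨hI, hJ'⟩ := h ha N hN
  refine ⟨fun c u => (hI c u).trans (mul_le_mul_of_nonneg_left ?_ hC), hJ'⟩
  have hN' : (0 : ℝ) < N := by exact_mod_cast hN
  have hx : (0 : ℝ) ≤ (supNorm (c - (N : ℤ) • u) : ℝ) := Nat.cast_nonneg _
  refine Real.exp_le_exp.mpr ?_
  have : δ / N ≤ deltaH 4 1 / N := div_le_div_of_nonneg_right hδle hN'.le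
  nlinarith

/-- **`ghost_mix1_rem` WITH THE PROFILE RATE FREE IN `(0, deltaH 4 1]`** ([our object]): for all `δ ∈ (0, deltaH 4 1]`, with the `Γ` letter (Γ) at rate `δ∕N` and the bound's
`δ`-numbers at `δ`, everything else as in `GhostLoopCountingMixGamma.ghost_mix1_rem`. -/
theorem ghost_mix1_rem_of_le :
    ∃ C C' : ℝ, 0 ≤ C ∧ 0 ≤ C' ∧ ∀ δ : ℝ, 0 < δ → δ ≤ deltaH 4 1 → ∀ {a : ℝ}, 0 < a → ∀ (N : ℕ), 1 ≤ N →
      ∀ {σ : Type*} [Fintype σ] {p : σ → ℝ} (_ : ∀ s, 0 ≤ p s)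
        {rad : σ → Pt → Pt → List Pt} {ℓ₀ R₀ : ℕ} (_ : ∀ s u x', (rad s u x').length ≤ ℓ₀)
        (_ : ∀ (s : σ) (u : Pt) (x : ↥(fineBlock N)) (ℓ : Pt), ℓ ∈ rad s u x.1 → supNorm (ℓ - (N : ℤ) • u) ≤ R₀ * N)
        {G Γ : Pt → Pt → ℝ} {C_G C_Γ : ℝ} (_ : ∀ u u', |G u u'| ≤ C_G)
        (_ : ∀ c c', |Γ c c'| ≤ C_Γ / ((supNorm (c - c') : ℝ) + 1) ^ 2 * Real.exp (-(δ / N) * (supNorm (c - c') : ℝ)))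
        (U : Pt → Finset Pt) (W S V : Finset Pt) (v₀ : Pt),
        ∑ v ∈ V, (supNorm (v - v₀) : ℝ) ^ 2 *
            |∑ b ∈ S, ∑ b' ∈ S, kerH (N - 1) a b v₀ * kerH (N - 1) a b' v *
              (∑ u ∈ U b, ∑ u' ∈ U b', G u' u *
                ∑ w ∈ W, ∑ w' ∈ W, ker₁ (sclW N p) (sclFld N u) (sclBg N u rad) b (b + w) * Γ (b + w) (b' + w') *
                  ker₁ (sclW N p) (sclFld N u') (sclBg N u' rad) b' (b' + w'))|
          ≤ 3 * C * C' * (1 + 16 / δ ^ 2) *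
            (C_G * (C_Γ * (3 + 8 * ((R₀ : ℝ) + 1) ^ 2)) *
              ((((ℓ₀ : ℕ) : ℝ) * (((N : ℝ) ^ 4)⁻¹ * ∑ s, p s)) *
                (((1 + 80 * Real.exp (δ / 4) * (4 / δ) ^ 2)
                  + (1 + 480 * Real.exp (δ / 4) * (4 / δ) ^ 4)) * (N : ℝ) ^ 2)) *
              ((((ℓ₀ : ℕ) : ℝ) * ∑ s, p s) * Real.exp (δ * R₀ / 2) *
                (Real.exp (δ / 2) * (1 + 480 * Real.exp (δ / 4) * (4 / δ) ^ 4)))) := by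
  obtain ⟨C, C', hC, hC', h⟩ := ghostColumn_engineLetters_of_le
  refine ⟨C, C', hC, hC', fun δ hδ hδle {a} ha N hN σ _ p hp rad ℓ₀ R₀ hrad hradR G Γ C_G C_Γ hG hΓ U W S V v₀ => ?_⟩
  obtain ⟨hI, hJ'⟩ := h δ hδ hδle ha N hN
  exact coarse_mix1_secondMoment_scl (N := N) hδ hN hp hrad hradR U W (J := fun b v => kerH (N - 1) a b v)
    hG hΓ S V v₀ (fun b => hI b v₀) (fun b' => hJ' b' V)

/-- **`ghost_mix3_rem` WITH THE PROFILE RATE FREE IN `(0, deltaH 4 1]`** ([our object]): for all `δ ∈ (0, deltaH 4 1]`, with the `Γ` letter (Γ₁) at rate `δ∕N` and the bound's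
`δ`-numbers at `δ` (the `Ḣ` rate `δ_H > 0` free as before), everything else as in `GhostLoopCountingMixCubic.ghost_mix3_rem`. -/
theorem ghost_mix3_rem_of_le :
    ∃ C C' : ℝ, 0 ≤ C ∧ 0 ≤ C' ∧ ∀ δ : ℝ, 0 < δ → δ ≤ deltaH 4 1 → ∀ {a : ℝ}, 0 < a → ∀ (N : ℕ), 1 ≤ N →
      ∀ {σ : Type*} [Fintype σ] {p : σ → ℝ} (_ : ∀ s, 0 ≤ p s)
        {rad : σ → Pt → Pt → List Pt} {ℓ₀ R₀ : ℕ} (_ : ∀ s u x', (rad s u x').length ≤ ℓ₀)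
        (_ : ∀ (s : σ) (u : Pt) (x : ↥(fineBlock N)) (ℓ : Pt), ℓ ∈ rad s u x.1 → supNorm (ℓ - (N : ℤ) • u) ≤ R₀ * N)
        {Γ : Pt → Pt → ℝ} {H : Pt → Pt → Pt → ℝ} {C_Γ C_Γ' C_H δH : ℝ} (_ : 0 < δH)
        (_ : ∀ c x, |Γ c x| ≤ C_Γ)
        (_ : ∀ c t (i : Fin 4), |Γ c (t + Pi.single i 1) - Γ c t|
          ≤ C_Γ' / ((supNorm (c - t) : ℝ) + 1) ^ 3 * Real.exp (-(δ / N) * (supNorm (c - t) : ℝ)))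
        (_ : ∀ b' x x', |H b' x x'| ≤ C_H * Real.exp (-δH * l1 (x - b')) * Real.exp (-δH * l1 (x' - b')))
        (_ : ∀ b' x', ∑' x, H b' x x' = 0)
        (U : Pt → Finset Pt) (W S V : Finset Pt) (v₀ : Pt),
        ∑ v ∈ V, (supNorm (v - v₀) : ℝ) ^ 2 *
            |∑ b ∈ S, ∑ b' ∈ S, kerH (N - 1) a b v₀ * kerH (N - 1) a b' v *
              (∑ u ∈ U b, ∑ w ∈ W, ker₁ (sclW N p) (sclFld N u) (sclBg N u rad) b (b + w) *
                ∑' x', kerH (N - 1) a x' u * ∑' x, Γ (b + w) x * H b' x x')|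
          ≤ 3 * C * C' * (1 + 16 / δ ^ 2) *
            ((C * (C_H * Zl 4 δH)) *
              ((256 / 27 * C_Γ' * (Real.exp (δH / 2) * (2 / δH) * Zl 4 (δH / 2)))
                  * ((1 + 2 * ((R₀ : ℝ) + 1) ^ 2) * (1 + 80 * Real.exp ((3 * δ / 4) / 2) * (2 / (3 * δ / 4)))
                    + 2 * (1 + 160 * Real.exp ((3 * δ / 4) / 2) * (2 / (3 * δ / 4)) ^ 3)) * N
                + (2 * C_Γ * 20 ^ 8 * (40320 * Real.exp (δH / 2) * (2 / δH) ^ 8 * Zl 4 (δH / 2))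
                    + (8 * C_Γ * (Real.exp (δH / 2) * (2 / δH) * Zl 4 (δH / 2)) + 2 * C_Γ * (Real.exp (δH / 2) * Zl 4 (δH / 2))) * 5 ^ 8)
                  * 81 * (3 + 2 * ((R₀ : ℝ) + 1) ^ 2)) *
              ((((ℓ₀ : ℕ) : ℝ) * ∑ s, p s) * Real.exp (δ * R₀ / 2) *
                (Real.exp (δ / 2) * (1 + 480 * Real.exp (δ / 4) * (4 / δ) ^ 4)))) := by
  obtain ⟨C, C', hC, hC', h⟩ := ghostColumn_engineLetters_of_le
  refine ⟨C, C', hC, hC', fun δ hδ hδle {a} ha N hN σ _ p hp rad ℓ₀ R₀ hrad hradR Γ H C_Γ C_Γ' C_H δH hδH hΓ0 hΓ1 hH hH0 U W S V v₀ => ?_⟩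
  obtain ⟨hI, hJ'⟩ := h δ hδ hδle ha N hN
  have hI0 : ∀ c u : Pt, |kerH (N - 1) a c u| ≤ C := by
    intro c u
    refine (hI c u).trans ?_
    have h1 : Real.exp (-(δ / N) * (supNorm (c - (N : ℤ) • u) : ℝ)) ≤ 1 := by
      apply Real.exp_le_one_iff.mpr
      have : (0 : ℝ) ≤ δ / N := by positivity
      have : (0 : ℝ) ≤ (supNorm (c - (N : ℤ) • u) : ℝ) := Nat.cast_nonneg _
      nlinarith
    calc C * Real.exp (-(δ / N) * (supNorm (c - (N : ℤ) • u) : ℝ)) ≤ C * 1 := mul_le_mul_of_nonneg_left h1 hC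
      _ = C := mul_one C
  exact coarse_mix3_secondMoment_scl (N := N) hδ hδH hN hp hrad hradR U W
    (I := fun c u => kerH (N - 1) a c u) (J := fun b v => kerH (N - 1) a b v)
    hI0 hΓ0 hΓ1 hH hH0 S V v₀ (fun b => hI b v₀) (fun b' => hJ' b' V)

end Summit.QuantumFields.BalabanUV.Beta.FP.GhostLoopCountingMixRate

end
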